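import Mathlib
import HarnessLib
import Summits.NavierStokesRegularity.NavierStokesRegularity.Theorems.PoloidalWindowDoorPoloidalWindowRigidityZShockAutReduction

/-!
# Crux K2 `PoloidalWindowRigidity` (stmt-NavierStokesRegularity-19708), line `z_shock` — a (TH)-INSTANT of the deciding stub is a GLOBAL
# constant-slope slice; the deciding stub reduced to the class-free slice Liouville statement plus the CONSTANT-SLOPE residue

`--supports stmt-NavierStokesRegularity-19708 --as helper` (leafhand-ns-poloidalwindowdoor-3 g12, cell decomp-ns, 2026-08-31).  Def-free;
tree files only.  **No stub and no summit is closed by this file; Navier–Stokes regularity is NOT proved here (rung 0).**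

Companion of `…ZShockAutReduction` (p835195), whose theorem `stub_zShockThickAut_of_sliceLiouville_of_thInstant` derives the registered type
of `stub_zShockThickAut` from `hGN` (class-free slice Liouville statement, genuinely nonlinear branch) and `hTH` (the stub verbatim on a slice
whose genuine-nonlinearity defect `D_b = ∂_b v₂·∇(∂₂v_b) − ∂₂v_b·∇(∂_b v₂)` vanishes identically at the densely hyperbolic time).  Here the
residue is READ: by slice analyticity, the (M)-frozen wedge law and one strictly hyperbolic window point, `D_b(t₀,·) ≡ 0` (`b = 0,1`) forces
ONE constant `c < 0` with `∂₂v_b(t₀,·) = c·∂_b v₂(t₀,·)` on ALL of `ℝ³` — a (TV)-type slice in the strongest sense, on which the height-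
evolution is the LINEAR wave equation `∂₂∂₂v₂ = −c Δₕv₂` (cf. `…ZShockHeightEvolution`; bounded eternal inhabitants exist, e.g. standing
waves, so this residue needs the (TH) column's Navier–Stokes dynamics, not the kinematic lever).
* `eq_const_mul_of_defect_eq_zero` — class-free ratio lemma: analytic `A, D` on `ℝ³`, `D·∇A − A·∇D ≡ 0`, `D(x₀) ≠ 0` ⟹ `A = (A(x₀)/D(x₀))·D`.
* `eq_const_mul_of_wedge` — transport of the constant to the other horizontal component through the wedge law.
* `constSlope_of_gnDefect_eq_zero` — class-free: analytic `f : ℝ³ → ℝ³`, wedge law, `D_b ≡ 0`, one strictly hyperbolic point ⟹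
  `∃ c < 0, ∂₂f_b = c·∂_b f₂` everywhere (`b = 0,1`).
* `wedge_slice_of_class` — the wedge law on every slice of a class profile (binders of the stubs; slab pressure + `…LocalFrozenLaw`).
* `stub_zShockThickAut_of_sliceLiouville_of_constSlope` — the registered type of `stub_zShockThickAut` VERBATIM from `hGN` (as in p835195)
  and `hTV₀` = the stub verbatim with the extra hypothesis «the densely hyperbolic slice `t₀ = z₀.1` carries a GLOBAL constant slope law
  `∂₂v_b = c·∂_b v₂`, `c < 0`».  So the deciding stub = (class-free R3-type statement, XL) + (constant-slope instants inside a THICK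
  twisting window, a (TH)-column statement at ONE instant).
HONEST LABEL: reduction / repair census in the kernel; closes no stub. [folklore]
-/

noncomputable section

namespace Summit.NavierStokesRegularity.NavierStokesRegularity.Theorems.PoloidalWindowDoorPoloidalWindowRigidityZShockThInstantSlope

-- the problem directory repeats the summit name (`NavierStokesRegularity/NavierStokesRegularity`)
set_option linter.dupNamespace false

open Set Filter Topology Function
open scoped RealInnerProductSpace InnerProductSpace
open Literature.Analysis Literature.Analysis.FluidPDE
open Summit.NavierStokesRegularity.NavierStokesRegularity.Theorems.LocalSineTubeDoorProfileAlignedWindowRigidityAncient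
open Summit.NavierStokesRegularity.NavierStokesRegularity.Theorems.PoloidalWindowDoorPoloidalWindowRigidityZShockAutReduction
open Summit.NavierStokesRegularity.NavierStokesRegularity.Theorems.PoloidalWindowDoorPoloidalWindowRigidityLocalFrozenLaw
  (vertShear_wedge_horizGrad_eq_zero)
open Summit.NavierStokesRegularity.NavierStokesRegularity.Theorems.PoloidalWindowDoorPoloidalWindowRigidityHorizontalSourceGauge
  (analyticOnNhd_fderiv_apply_coord)
open Summit.NavierStokesRegularity.NavierStokesRegularity.Theorems.PoloidalWindowDoorPoloidalWindowRigidityWindow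
  (isTypeIAncientMild_of_class)

/-! ## Class-free core

If on the densely hyperbolic slice the genuine-nonlinearity defect `D_b = ∂_b u₂·∇(∂₂u_b) − ∂₂u_b·∇(∂_b u₂)` vanishes identically for
`b = 0, 1` (the extra hypothesis of `hTH` in `…ZShockAutReduction.stub_zShockThickAut_of_sliceLiouville_of_thInstant`), then — slice analyticity, the wedge law and ONE strictly hyperbolic point — there is ONE
constant `c < 0` with `∂₂u_b = c·∂_b u₂` on ALL of `ℝ³`, `b = 0, 1`: the slice is a (TH)/(TV)-slice in the strongest, global sense (and then
`∂₂∂₂u₂ = −c·Δₕu₂`, the LINEAR wave equation in the height, cf. `…ZShockHeightEvolution`).  So the residue `hTH` may be replaced by the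
stub restricted to slices carrying a global constant negative slope law (`stub_zShockThickAut_of_sliceLiouville_of_constSlope`). -/

/-- **Ratio lemma.**  Real-analytic `A, D : ℝ³ → ℝ` with `D·∇A − A·∇D ≡ 0` and `D(x₀) ≠ 0`: then `A = (A(x₀)/D(x₀))·D` on all of `ℝ³`
(the quotient `A/D` has zero derivative near `x₀`, so `A − cD` vanishes near `x₀`, hence everywhere by the identity theorem). [folklore] -/
theorem eq_const_mul_of_defect_eq_zero {A D : EuclideanSpace ℝ (Fin 3) → ℝ}
    (hA : AnalyticOnNhd ℝ A univ) (hD : AnalyticOnNhd ℝ D univ)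
    (hN : ∀ x p : EuclideanSpace ℝ (Fin 3), D x * fderiv ℝ A x p - A x * fderiv ℝ D x p = 0)
    {x₀ : EuclideanSpace ℝ (Fin 3)} (hx₀ : D x₀ ≠ 0) :
    ∀ y, A y = (A x₀ / D x₀) * D y := by
  set c : ℝ := A x₀ / D x₀ with hc
  -- a ball around `x₀` on which `D ≠ 0`
  have hDcont : Continuous D := continuousOn_univ.1 hD.continuousOn
  have hev : ∀ᶠ y in 𝓝 x₀, D y ≠ 0 := hDcont.continuousAt.eventually_ne hx₀
  obtain ⟨r, hr, hball⟩ := Metric.eventually_nhds_iff_ball.1 hev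
  -- the quotient `Λ = A/D` is differentiable on the ball with zero derivative
  set Λ : EuclideanSpace ℝ (Fin 3) → ℝ := fun y => A y * (D y)⁻¹ with hΛ
  have hΛd : ∀ y ∈ Metric.ball x₀ r, DifferentiableAt ℝ Λ y := fun y hy =>
    ((hA y (mem_univ _)).differentiableAt).mul (((hD y (mem_univ _)).differentiableAt).inv (hball y hy))
  have hΛ0 : ∀ y ∈ Metric.ball x₀ r, fderiv ℝ Λ y = 0 := by
    intro y hy
    ext p
    -- derivatives along the line `t ↦ y + t • p`
    have hγ : HasDerivAt (fun t : ℝ => y + t • p) p 0 := by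
      simpa using ((hasDerivAt_id (0 : ℝ)).smul_const p).const_add y
    have hy0 : y = y + (0 : ℝ) • p := by simp
    have hAγ : HasDerivAt (fun t : ℝ => A (y + t • p)) (fderiv ℝ A y p) 0 :=
      ((hA y (mem_univ _)).differentiableAt.hasFDerivAt).comp_hasDerivAt_of_eq (0 : ℝ) hγ hy0
    have hDγ : HasDerivAt (fun t : ℝ => D (y + t • p)) (fderiv ℝ D y p) 0 :=
      ((hD y (mem_univ _)).differentiableAt.hasFDerivAt).comp_hasDerivAt_of_eq (0 : ℝ) hγ hy0
    have hΛγ : HasDerivAt (fun t : ℝ => Λ (y + t • p)) (fderiv ℝ Λ y p) 0 :=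
      ((hΛd y hy).hasFDerivAt).comp_hasDerivAt_of_eq (0 : ℝ) hγ hy0
    have hDy0 : (fun t : ℝ => D (y + t • p)) 0 ≠ 0 := by simpa using hball y hy
    have hq : HasDerivAt (fun t : ℝ => A (y + t • p) / D (y + t • p))
        ((fderiv ℝ A y p * (fun t : ℝ => D (y + t • p)) 0 - (fun t : ℝ => A (y + t • p)) 0 * fderiv ℝ D y p) /
          (fun t : ℝ => D (y + t • p)) 0 ^ 2) 0 :=
      hAγ.fun_div hDγ hDy0
    have hq' : HasDerivAt (fun t : ℝ => Λ (y + t • p))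
        ((fderiv ℝ A y p * (fun t : ℝ => D (y + t • p)) 0 - (fun t : ℝ => A (y + t • p)) 0 * fderiv ℝ D y p) /
          (fun t : ℝ => D (y + t • p)) 0 ^ 2) 0 :=
      hq.congr_of_eventuallyEq (Filter.Eventually.of_forall fun t => by simp [hΛ, div_eq_mul_inv])
    rw [hΛγ.unique hq']
    have hnum : fderiv ℝ A y p * D y - A y * fderiv ℝ D y p = 0 := by
      have h := hN y p
      linear_combination h
    simp [hnum]
  -- `Λ` is constant on the ball
  have hΛc : ∀ y ∈ Metric.ball x₀ r, Λ y = Λ x₀ := fun y hy =>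
    (convex_ball x₀ r).is_const_of_fderivWithin_eq_zero (𝕜 := ℝ)
      (fun z hz => (hΛd z hz).differentiableWithinAt)
      (fun z hz => by rw [fderivWithin_of_isOpen Metric.isOpen_ball hz]; exact hΛ0 z hz) hy (Metric.mem_ball_self hr)
  -- hence `A − c·D` vanishes on the ball, and everywhere by the identity theorem
  have hF : AnalyticOnNhd ℝ (fun y => A y - c * D y) univ := hA.sub (analyticOnNhd_const.mul hD)
  have hFz : (fun y => A y - c * D y) =ᶠ[𝓝 x₀] 0 := by
    filter_upwards [Metric.ball_mem_nhds x₀ hr] with y hy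
    have h1 : A y * (D y)⁻¹ = A x₀ * (D x₀)⁻¹ := hΛc y hy
    have hDy : D y ≠ 0 := hball y hy
    have h2 : A y = A x₀ * (D x₀)⁻¹ * D y := by
      rw [← h1, mul_assoc, inv_mul_cancel₀ hDy, mul_one]
    show A y - c * D y = 0
    rw [h2, hc, div_eq_mul_inv, sub_self]
  intro y
  have h := hF.eqOn_zero_of_preconnected_of_eventuallyEq_zero isPreconnected_univ (mem_univ x₀) hFz (mem_univ y)
  exact sub_eq_zero.1 h

/-- **Transport by the wedge law.**  Real-analytic `A₁, D₀, D₁ : ℝ³ → ℝ` with `c·D₀·D₁ − A₁·D₀ ≡ 0` and `D₀(x₀) ≠ 0`: then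
`A₁ = c·D₁` on all of `ℝ³` (near `x₀` divide by `D₀`; identity theorem). [folklore] -/
theorem eq_const_mul_of_wedge {A₁ D₀ D₁ : EuclideanSpace ℝ (Fin 3) → ℝ}
    (hA₁ : AnalyticOnNhd ℝ A₁ univ) (hD₀ : AnalyticOnNhd ℝ D₀ univ) (hD₁ : AnalyticOnNhd ℝ D₁ univ) {c : ℝ}
    (hw : ∀ y, c * D₀ y * D₁ y - A₁ y * D₀ y = 0) {x₀ : EuclideanSpace ℝ (Fin 3)} (hx₀ : D₀ x₀ ≠ 0) :
    ∀ y, A₁ y = c * D₁ y := by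
  have hDcont : Continuous D₀ := continuousOn_univ.1 hD₀.continuousOn
  have hev : ∀ᶠ y in 𝓝 x₀, D₀ y ≠ 0 := hDcont.continuousAt.eventually_ne hx₀
  have hF : AnalyticOnNhd ℝ (fun y => A₁ y - c * D₁ y) univ := hA₁.sub (analyticOnNhd_const.mul hD₁)
  have hFz : (fun y => A₁ y - c * D₁ y) =ᶠ[𝓝 x₀] 0 := by
    filter_upwards [hev] with y hy
    have h := hw y
    have h' : D₀ y * (A₁ y - c * D₁ y) = 0 := by linear_combination (-1 : ℝ) * h
    simpa [hy] using h'
  intro y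
  have h := hF.eqOn_zero_of_preconnected_of_eventuallyEq_zero isPreconnected_univ (mem_univ x₀) hFz (mem_univ y)
  exact sub_eq_zero.1 h

/-- **A (TH)-instant is a GLOBAL constant-slope slice.**  For a real-analytic `f : ℝ³ → ℝ³` with the wedge law
`∂₂f₀·∂₁f₂ = ∂₂f₁·∂₀f₂`, vanishing genuine-nonlinearity defects `∂_b f₂·∇(∂₂f_b) − ∂₂f_b·∇(∂_b f₂) ≡ 0` (`b = 0, 1`) and one strictly
hyperbolic point (`∂₂f₀∂₀f₂ + ∂₂f₁∂₁f₂ < 0` somewhere), there is ONE constant `c < 0` with `∂₂f_b = c·∂_b f₂` everywhere, `b = 0, 1`.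
[folklore] -/
theorem constSlope_of_gnDefect_eq_zero {f : EuclideanSpace ℝ (Fin 3) → EuclideanSpace ℝ (Fin 3)} (hf : AnalyticOnNhd ℝ f univ)
    (hwedge : ∀ y, fderiv ℝ f y (EuclideanSpace.single 2 1) 0 * fderiv ℝ f y (EuclideanSpace.single 1 1) 2 -
      fderiv ℝ f y (EuclideanSpace.single 2 1) 1 * fderiv ℝ f y (EuclideanSpace.single 0 1) 2 = 0)
    (hN : ∀ b : Fin 3, b ≠ 2 → ∀ x p : EuclideanSpace ℝ (Fin 3),
      fderiv ℝ f x (EuclideanSpace.single b 1) 2 *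
          fderiv ℝ (fun y => fderiv ℝ f y (EuclideanSpace.single 2 1) b) x p -
        fderiv ℝ f x (EuclideanSpace.single 2 1) b *
          fderiv ℝ (fun y => fderiv ℝ f y (EuclideanSpace.single b 1) 2) x p = 0)
    (hx₀ : ∃ x₀, fderiv ℝ f x₀ (EuclideanSpace.single 2 1) 0 * fderiv ℝ f x₀ (EuclideanSpace.single 0 1) 2 +
      fderiv ℝ f x₀ (EuclideanSpace.single 2 1) 1 * fderiv ℝ f x₀ (EuclideanSpace.single 1 1) 2 < 0) :
    ∃ c : ℝ, c < 0 ∧ ∀ y, ∀ b : Fin 3, b ≠ 2 →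
      fderiv ℝ f y (EuclideanSpace.single 2 1) b = c * fderiv ℝ f y (EuclideanSpace.single b 1) 2 := by
  obtain ⟨x₀, hx₀⟩ := hx₀
  -- names: `A b = ∂₂f_b`, `D b = ∂_b f₂`
  set A : Fin 3 → EuclideanSpace ℝ (Fin 3) → ℝ := fun b y => fderiv ℝ f y (EuclideanSpace.single 2 1) b with hAdef
  set D : Fin 3 → EuclideanSpace ℝ (Fin 3) → ℝ := fun b y => fderiv ℝ f y (EuclideanSpace.single b 1) 2 with hDdef
  have hAan : ∀ b, AnalyticOnNhd ℝ (A b) univ := fun b => analyticOnNhd_fderiv_apply_coord hf _ b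
  have hDan : ∀ b, AnalyticOnNhd ℝ (D b) univ := fun b => analyticOnNhd_fderiv_apply_coord hf _ 2
  have hN' : ∀ b : Fin 3, b ≠ 2 → ∀ x p, D b x * fderiv ℝ (A b) x p - A b x * fderiv ℝ (D b) x p = 0 :=
    fun b hb x p => hN b hb x p
  have hw' : ∀ y, A 0 y * D 1 y - A 1 y * D 0 y = 0 := fun y => hwedge y
  have hE : A 0 x₀ * D 0 x₀ + A 1 x₀ * D 1 x₀ < 0 := hx₀
  -- conclusion in the `A`/`D` names
  suffices h : ∃ c : ℝ, c < 0 ∧ (∀ y, A 0 y = c * D 0 y) ∧ (∀ y, A 1 y = c * D 1 y) by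
    obtain ⟨c, hc, h0, h1⟩ := h
    refine ⟨c, hc, fun y b hb => ?_⟩
    fin_cases b
    · exact h0 y
    · exact h1 y
    · exact absurd rfl hb
  by_cases hD0 : D 0 x₀ ≠ 0
  · -- base component `b = 0`
    set c : ℝ := A 0 x₀ / D 0 x₀ with hc
    have h0 : ∀ y, A 0 y = c * D 0 y := eq_const_mul_of_defect_eq_zero (hAan 0) (hDan 0) (hN' 0 (by decide)) hD0
    have h1 : ∀ y, A 1 y = c * D 1 y := by
      refine eq_const_mul_of_wedge (hAan 1) (hDan 0) (hDan 1) (fun y => ?_) hD0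
      have h := hw' y
      rw [h0 y] at h
      linear_combination h
    refine ⟨c, ?_, h0, h1⟩
    have hEc : c * (D 0 x₀ ^ 2 + D 1 x₀ ^ 2) < 0 := by
      have h := hE
      rw [h0 x₀, h1 x₀] at h
      nlinarith [h]
    have hQ : 0 < D 0 x₀ ^ 2 + D 1 x₀ ^ 2 := by positivity
    by_contra hcn
    push Not at hcn
    exact absurd hEc (not_lt.2 (mul_nonneg hcn hQ.le))
  · -- `D 0 x₀ = 0`: then `D 1 x₀ ≠ 0` by strict hyperbolicity; base component `b = 1`
    push Not at hD0
    have hD1 : D 1 x₀ ≠ 0 := by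
      intro h1
      have h := hE
      rw [hD0, h1, mul_zero, mul_zero, add_zero] at h
      exact lt_irrefl _ h
    set c : ℝ := A 1 x₀ / D 1 x₀ with hc
    have h1 : ∀ y, A 1 y = c * D 1 y := eq_const_mul_of_defect_eq_zero (hAan 1) (hDan 1) (hN' 1 (by decide)) hD1
    have h0 : ∀ y, A 0 y = c * D 0 y := by
      refine eq_const_mul_of_wedge (hAan 0) (hDan 1) (hDan 0) (fun y => ?_) hD1
      have h := hw' y
      rw [h1 y] at h
      linear_combination (-1 : ℝ) * h
    refine ⟨c, ?_, h0, h1⟩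
    have hEc : c * (D 0 x₀ ^ 2 + D 1 x₀ ^ 2) < 0 := by
      have h := hE
      rw [h0 x₀, h1 x₀] at h
      nlinarith [h]
    have hQ : 0 < D 0 x₀ ^ 2 + D 1 x₀ ^ 2 := by positivity
    by_contra hcn
    push Not at hcn
    exact absurd hEc (not_lt.2 (mul_nonneg hcn hQ.le))


/-! ## Class level -/

/-- **The wedge law on every slice of a class profile** (`∂₂v₀·∂₁v₂ = ∂₂v₁·∂₀v₂` on `{t} × ℝ³`, `t < 0`): the `e₃`-component of the
vorticity equation of the poloidal classical solution carried by the class (slab pressure from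
`exists_isClassicalNSSolutionOn_Iio_of_isTypeIAncientMild`, identity from `…LocalFrozenLaw.vertShear_wedge_horizGrad_eq_zero`). [folklore] -/
theorem wedge_slice_of_class {C : ℝ} {v : ℝ → EuclideanSpace ℝ (Fin 3) → EuclideanSpace ℝ (Fin 3)}
    (hrate : Literature.Analysis.FluidPDE.HasTypeITimeDecay C v)
    (hcont : ContinuousOn (Function.uncurry v) (Set.Iio (0 : ℝ) ×ˢ Set.univ))
    (hmild : ∀ s t : ℝ, s < t → t < 0 → ∀ x, v t x =
      Literature.Analysis.UnboundedOperators.heatExtension (v s) (t - s) x -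
        Literature.Analysis.FluidPDE.oseenDuhamel 1 s v v t x)
    (hdiv : ∀ t < 0, Literature.Analysis.FluidPDE.VectorCalculus.IsDivFree (v t))
    (hpol : ∀ s < 0, ∀ y, ⟪Literature.Analysis.FluidPDE.curl (v s) y, EuclideanSpace.single 2 1⟫_ℝ = 0)
    {t : ℝ} (ht : t < 0) (y : EuclideanSpace ℝ (Fin 3)) :
    fderiv ℝ (v t) y (EuclideanSpace.single 2 1) 0 * fderiv ℝ (v t) y (EuclideanSpace.single 1 1) 2 -
      fderiv ℝ (v t) y (EuclideanSpace.single 2 1) 1 * fderiv ℝ (v t) y (EuclideanSpace.single 0 1) 2 = 0 := by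
  obtain ⟨q, hq⟩ := exists_isClassicalNSSolutionOn_Iio_of_isTypeIAncientMild (isTypeIAncientMild_of_class hrate hcont hmild hdiv)
  have hslab : IsOpen (Set.Iio (0 : ℝ) ×ˢ (Set.univ : Set (EuclideanSpace ℝ (Fin 3)))) := isOpen_Iio.prod isOpen_univ
  have hpol' : ∀ p ∈ Set.Iio (0 : ℝ) ×ˢ (Set.univ : Set (EuclideanSpace ℝ (Fin 3))),
      ⟪curl (v p.1) p.2, EuclideanSpace.single 2 (1 : ℝ)⟫_ℝ = 0 :=
    fun p hp => hpol p.1 (Set.mem_prod.1 hp).1 p.2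
  exact vertShear_wedge_horizGrad_eq_zero hslab hq.onRegion hpol' (p := (t, y)) (Set.mk_mem_prod ht (Set.mem_univ y))

/-- **The deciding stub `stub_zShockThickAut`, reduced to the class-free slice Liouville statement `hGN` (genuinely nonlinear branch, as in
`…ZShockAutReduction`) and the CONSTANT-SLOPE residue `hTV₀`** (the stub verbatim with the extra hypothesis that the densely hyperbolic slice
`t₀ = z₀.1` carries a GLOBAL constant slope law `∂₂v_b = c·∂_b v₂`, `c < 0`, `b = 0,1`).  Conclusion: the registered type of
`stub_zShockThickAut` VERBATIM.  Proof: `stub_zShockThickAut_of_sliceLiouville_of_thInstant` with its (TH)-instant hypothesis discharged by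
`constSlope_of_gnDefect_eq_zero` (slice analyticity, `wedge_slice_of_class`, the window point's strict hyperbolicity) and `hTV₀`. [folklore] -/
theorem stub_zShockThickAut_of_sliceLiouville_of_constSlope
    (hGN : ∀ (u : EuclideanSpace ℝ (Fin 3) → EuclideanSpace ℝ (Fin 3)),
      AnalyticOnNhd ℝ u Set.univ →
      (∃ M : ℝ, ∀ x, ‖u x‖ ≤ M) →
      (∃ M₁ : ℝ, ∀ x, ‖fderiv ℝ u x‖ ≤ M₁) →
      Literature.Analysis.FluidPDE.VectorCalculus.IsDivFree u →
      (∀ y, ⟪Literature.Analysis.FluidPDE.curl u y, EuclideanSpace.single 2 1⟫_ℝ = 0) →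
      (∀ y, fderiv ℝ u y (EuclideanSpace.single 2 1) 0 * fderiv ℝ u y (EuclideanSpace.single 1 1) 2 -
        fderiv ℝ u y (EuclideanSpace.single 2 1) 1 * fderiv ℝ u y (EuclideanSpace.single 0 1) 2 = 0) →
      (∀ b : Fin 3, b ≠ 2 → ∀ x p q : EuclideanSpace ℝ (Fin 3),
        (fderiv ℝ u x (EuclideanSpace.single b 1) 2 *
              fderiv ℝ (fun y => fderiv ℝ u y (EuclideanSpace.single 2 1) b) x p -
            fderiv ℝ u x (EuclideanSpace.single 2 1) b *
              fderiv ℝ (fun y => fderiv ℝ u y (EuclideanSpace.single b 1) 2) x p) *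
            fderiv ℝ (fun y => u y 2) x q -
          (fderiv ℝ u x (EuclideanSpace.single b 1) 2 *
              fderiv ℝ (fun y => fderiv ℝ u y (EuclideanSpace.single 2 1) b) x q -
            fderiv ℝ u x (EuclideanSpace.single 2 1) b *
              fderiv ℝ (fun y => fderiv ℝ u y (EuclideanSpace.single b 1) 2) x q) *
            fderiv ℝ (fun y => u y 2) x p = 0) →
      (∀ y, fderiv ℝ u y (EuclideanSpace.single 2 1) 0 * fderiv ℝ u y (EuclideanSpace.single 0 1) 2 +
        fderiv ℝ u y (EuclideanSpace.single 2 1) 1 * fderiv ℝ u y (EuclideanSpace.single 1 1) 2 ≤ 0) →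
      (∃ y, fderiv ℝ u y (EuclideanSpace.single 2 1) 0 * fderiv ℝ u y (EuclideanSpace.single 0 1) 2 +
        fderiv ℝ u y (EuclideanSpace.single 2 1) 1 * fderiv ℝ u y (EuclideanSpace.single 1 1) 2 < 0) →
      (∃ y, fderiv ℝ (fun x => fderiv ℝ u x (EuclideanSpace.single 2 1) 2) y (EuclideanSpace.single 0 1) *
            fderiv ℝ u y (EuclideanSpace.single 1 1) 2 -
          fderiv ℝ (fun x => fderiv ℝ u x (EuclideanSpace.single 2 1) 2) y (EuclideanSpace.single 1 1) *
            fderiv ℝ u y (EuclideanSpace.single 0 1) 2 ≠ 0) →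
      (∃ b : Fin 3, b ≠ 2 ∧ ∃ x p : EuclideanSpace ℝ (Fin 3),
        fderiv ℝ u x (EuclideanSpace.single b 1) 2 *
            fderiv ℝ (fun y => fderiv ℝ u y (EuclideanSpace.single 2 1) b) x p -
          fderiv ℝ u x (EuclideanSpace.single 2 1) b *
            fderiv ℝ (fun y => fderiv ℝ u y (EuclideanSpace.single b 1) 2) x p ≠ 0) →
      False)
    (hTV₀ : ∀ (C : ℝ) (v : ℝ → EuclideanSpace ℝ (Fin 3) → EuclideanSpace ℝ (Fin 3)),
      Literature.Analysis.FluidPDE.HasTypeITimeDecay C v →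
      ContinuousOn (Function.uncurry v) (Set.Iio (0 : ℝ) ×ˢ Set.univ) →
      (∀ s t : ℝ, s < t → t < 0 → ∀ x, v t x =
        Literature.Analysis.UnboundedOperators.heatExtension (v s) (t - s) x -
          Literature.Analysis.FluidPDE.oseenDuhamel 1 s v v t x) →
      (∀ t < 0, Literature.Analysis.FluidPDE.VectorCalculus.IsDivFree (v t)) →
      (∀ s < 0, ∀ y, ⟪Literature.Analysis.FluidPDE.curl (v s) y, EuclideanSpace.single 2 1⟫_ℝ = 0) →
      ∀ W : Set (ℝ × EuclideanSpace ℝ (Fin 3)), IsOpen W → W.Nonempty → W ⊆ Set.Iio (0 : ℝ) ×ˢ Set.univ →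
        (∀ z ∈ W, Literature.Analysis.FluidPDE.curl (v z.1) z.2 ≠ 0 ∧
          (fderiv ℝ (v z.1) z.2 (EuclideanSpace.single 0 1) 2 ≠ 0 ∨ fderiv ℝ (v z.1) z.2 (EuclideanSpace.single 1 1) 2 ≠ 0) ∧
          (fderiv ℝ (v z.1) z.2 (EuclideanSpace.single 2 1) 0 ≠ 0 ∨ fderiv ℝ (v z.1) z.2 (EuclideanSpace.single 2 1) 1 ≠ 0)) →
        (∀ m : ℝ → ℝ, ∀ W₁ : Set (ℝ × EuclideanSpace ℝ (Fin 3)), W₁ ⊆ W → IsOpen W₁ → W₁.Nonempty →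
          ∃ z ∈ W₁, ∃ b : Fin 3, b ≠ 2 ∧
            fderiv ℝ (v z.1) z.2 (EuclideanSpace.single 2 1) b ≠
              m z.1 * fderiv ℝ (v z.1) z.2 (EuclideanSpace.single b 1) 2) →
        (∀ z ∈ W,
          fderiv ℝ (fun x => fderiv ℝ (v z.1) x (EuclideanSpace.single 2 1) 2) z.2 (EuclideanSpace.single 0 1) *
              fderiv ℝ (v z.1) z.2 (EuclideanSpace.single 1 1) 2 -
            fderiv ℝ (fun x => fderiv ℝ (v z.1) x (EuclideanSpace.single 2 1) 2) z.2 (EuclideanSpace.single 1 1) *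
              fderiv ℝ (v z.1) z.2 (EuclideanSpace.single 0 1) 2 ≠ 0) →
        (∀ z ∈ W,
          fderiv ℝ (v z.1) z.2 (EuclideanSpace.single 2 1) 0 * fderiv ℝ (v z.1) z.2 (EuclideanSpace.single 0 1) 2 +
            fderiv ℝ (v z.1) z.2 (EuclideanSpace.single 2 1) 1 * fderiv ℝ (v z.1) z.2 (EuclideanSpace.single 1 1) 2 < 0) →
        (∀ m : ℝ → ℝ → ℝ, ∀ W₁ : Set (ℝ × EuclideanSpace ℝ (Fin 3)), W₁ ⊆ W → IsOpen W₁ → W₁.Nonempty →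
          ∃ z ∈ W₁, ∃ b : Fin 3, b ≠ 2 ∧
            fderiv ℝ (v z.1) z.2 (EuclideanSpace.single 2 1) b ≠
              m z.1 (z.2 2) * fderiv ℝ (v z.1) z.2 (EuclideanSpace.single b 1) 2) →
        ∀ z₀ ∈ W, Dense {y : EuclideanSpace ℝ (Fin 3) |
            fderiv ℝ (v z₀.1) y (EuclideanSpace.single 2 1) 0 * fderiv ℝ (v z₀.1) y (EuclideanSpace.single 0 1) 2 +
              fderiv ℝ (v z₀.1) y (EuclideanSpace.single 2 1) 1 * fderiv ℝ (v z₀.1) y (EuclideanSpace.single 1 1) 2 < 0} →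
        (∃ g : ℝ → ℝ → ℝ, ∃ W₁ : Set (ℝ × EuclideanSpace ℝ (Fin 3)), W₁ ⊆ W ∧ IsOpen W₁ ∧ z₀ ∈ W₁ ∧
          ∀ z ∈ W₁, ∀ b : Fin 3, b ≠ 2 →
            fderiv ℝ (v z.1) z.2 (EuclideanSpace.single 2 1) b =
              g z.1 (v z.1 z.2 2) * fderiv ℝ (v z.1) z.2 (EuclideanSpace.single b 1) 2) →
        (∃ c : ℝ, c < 0 ∧ ∀ y : EuclideanSpace ℝ (Fin 3), ∀ b : Fin 3, b ≠ 2 →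
          fderiv ℝ (v z₀.1) y (EuclideanSpace.single 2 1) b = c * fderiv ℝ (v z₀.1) y (EuclideanSpace.single b 1) 2) →
        ¬ Literature.Analysis.FluidPDE.IsBackwardSingularPoint v 0) :
    ∀ (C : ℝ) (v : ℝ → EuclideanSpace ℝ (Fin 3) → EuclideanSpace ℝ (Fin 3)),
      Literature.Analysis.FluidPDE.HasTypeITimeDecay C v →
      ContinuousOn (Function.uncurry v) (Set.Iio (0 : ℝ) ×ˢ Set.univ) →
      (∀ s t : ℝ, s < t → t < 0 → ∀ x, v t x =
        Literature.Analysis.UnboundedOperators.heatExtension (v s) (t - s) x -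
          Literature.Analysis.FluidPDE.oseenDuhamel 1 s v v t x) →
      (∀ t < 0, Literature.Analysis.FluidPDE.VectorCalculus.IsDivFree (v t)) →
      (∀ s < 0, ∀ y, ⟪Literature.Analysis.FluidPDE.curl (v s) y, EuclideanSpace.single 2 1⟫_ℝ = 0) →
      ∀ W : Set (ℝ × EuclideanSpace ℝ (Fin 3)), IsOpen W → W.Nonempty → W ⊆ Set.Iio (0 : ℝ) ×ˢ Set.univ →
        (∀ z ∈ W, Literature.Analysis.FluidPDE.curl (v z.1) z.2 ≠ 0 ∧
          (fderiv ℝ (v z.1) z.2 (EuclideanSpace.single 0 1) 2 ≠ 0 ∨ fderiv ℝ (v z.1) z.2 (EuclideanSpace.single 1 1) 2 ≠ 0) ∧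
          (fderiv ℝ (v z.1) z.2 (EuclideanSpace.single 2 1) 0 ≠ 0 ∨ fderiv ℝ (v z.1) z.2 (EuclideanSpace.single 2 1) 1 ≠ 0)) →
        (∀ m : ℝ → ℝ, ∀ W₁ : Set (ℝ × EuclideanSpace ℝ (Fin 3)), W₁ ⊆ W → IsOpen W₁ → W₁.Nonempty →
          ∃ z ∈ W₁, ∃ b : Fin 3, b ≠ 2 ∧
            fderiv ℝ (v z.1) z.2 (EuclideanSpace.single 2 1) b ≠
              m z.1 * fderiv ℝ (v z.1) z.2 (EuclideanSpace.single b 1) 2) →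
        (∀ z ∈ W,
          fderiv ℝ (fun x => fderiv ℝ (v z.1) x (EuclideanSpace.single 2 1) 2) z.2 (EuclideanSpace.single 0 1) *
              fderiv ℝ (v z.1) z.2 (EuclideanSpace.single 1 1) 2 -
            fderiv ℝ (fun x => fderiv ℝ (v z.1) x (EuclideanSpace.single 2 1) 2) z.2 (EuclideanSpace.single 1 1) *
              fderiv ℝ (v z.1) z.2 (EuclideanSpace.single 0 1) 2 ≠ 0) →
        (∀ z ∈ W,
          fderiv ℝ (v z.1) z.2 (EuclideanSpace.single 2 1) 0 * fderiv ℝ (v z.1) z.2 (EuclideanSpace.single 0 1) 2 +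
            fderiv ℝ (v z.1) z.2 (EuclideanSpace.single 2 1) 1 * fderiv ℝ (v z.1) z.2 (EuclideanSpace.single 1 1) 2 < 0) →
        (∀ m : ℝ → ℝ → ℝ, ∀ W₁ : Set (ℝ × EuclideanSpace ℝ (Fin 3)), W₁ ⊆ W → IsOpen W₁ → W₁.Nonempty →
          ∃ z ∈ W₁, ∃ b : Fin 3, b ≠ 2 ∧
            fderiv ℝ (v z.1) z.2 (EuclideanSpace.single 2 1) b ≠
              m z.1 (z.2 2) * fderiv ℝ (v z.1) z.2 (EuclideanSpace.single b 1) 2) →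
        ∀ z₀ ∈ W, Dense {y : EuclideanSpace ℝ (Fin 3) |
            fderiv ℝ (v z₀.1) y (EuclideanSpace.single 2 1) 0 * fderiv ℝ (v z₀.1) y (EuclideanSpace.single 0 1) 2 +
              fderiv ℝ (v z₀.1) y (EuclideanSpace.single 2 1) 1 * fderiv ℝ (v z₀.1) y (EuclideanSpace.single 1 1) 2 < 0} →
        (∃ g : ℝ → ℝ → ℝ, ∃ W₁ : Set (ℝ × EuclideanSpace ℝ (Fin 3)), W₁ ⊆ W ∧ IsOpen W₁ ∧ z₀ ∈ W₁ ∧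
          ∀ z ∈ W₁, ∀ b : Fin 3, b ≠ 2 →
            fderiv ℝ (v z.1) z.2 (EuclideanSpace.single 2 1) b =
              g z.1 (v z.1 z.2 2) * fderiv ℝ (v z.1) z.2 (EuclideanSpace.single b 1) 2) →
        ¬ Literature.Analysis.FluidPDE.IsBackwardSingularPoint v 0 := by
  refine stub_zShockThickAut_of_sliceLiouville_of_thInstant hGN ?_
  intro C v hrate hcont hmild hdiv hpol W hW hWne hWs hnd hpin htw hhyp hthick z₀ hz₀ hD hA hN
  have ht₀ : z₀.1 < 0 := (Set.mem_prod.1 (hWs hz₀)).1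
  have han : AnalyticOnNhd ℝ (v z₀.1) univ :=
    analyticOnNhd_slice hcont (bdd_of_hasTypeITimeDecay hrate) hmild ht₀
  have hconst := constSlope_of_gnDefect_eq_zero han (wedge_slice_of_class hrate hcont hmild hdiv hpol ht₀) hN
    ⟨z₀.2, hhyp z₀ hz₀⟩
  exact hTV₀ C v hrate hcont hmild hdiv hpol W hW hWne hWs hnd hpin htw hhyp hthick z₀ hz₀ hD hA hconst

end Summit.NavierStokesRegularity.NavierStokesRegularity.Theorems.PoloidalWindowDoorPoloidalWindowRigidityZShockThInstantSlope
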